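import Summits.CriticalPhenomena.PercolationContinuityZ3.Theorems.PercNearOneGluingNoHeavyLowerTailQ44TwoLayerSlicing

/-!
# The weight side of the two-layer slicing recursion: the antichain potential `Φ_ω`

Support file for crux `stmt-CriticalPhenomena-4575` (master-family programme, quadratic four-point row `Q44`), seat `prim-bnk-1`
gen 25; memo `run/shared/lean/prim/prim-l12/FROM-prim-bnk-1-gen25-OMEGA-WEIGHT.md` §1–§2.

`…Q44TwoLayerSlicing` (gen 24) proved the VALUE inequality of the tower-free recursion R5 on two-layer families `(A, P)`:
`#IQ outer + #IQ inner ≤ #IQ (A, P)` at every element `e`, for any symmetric `Q` and support / domination relations given by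
`Q`-row inclusion.  What an inductive proof of the click count `(AC₀)` still needs is a WEIGHT `Φ` with `Φ(root) = w`,
`Φ ≤ 2·#IQ` at the leaves and `Φ(A) ≤ Φ(outer) + Φ(inner)` at every split (memo gen 24 §4–§5: every point-local and pair-local
candidate fails).  This file supplies the weight: for a row map `r : T → Finset U` and a member predicate `Mem`, put

  `ω A := number of maximal elements (for ⊂) of {r a : a ∈ A, Mem a}`,   `Φ_ω A := ∑_X ω (A X)`.

**Theorem (`TwoLayerMS.phiOmega_le_outer_add_inner`).**  If no member row is contained in a non-member row, then for EVERY
two-layer family `A` and EVERY element `e`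

  `Φ_ω A ≤ Φ_ω (outerA A e) + Φ_ω (innerA A e S D)`,   `S a₀ a₁ := r a₁ ⊆ r a₀`,  `D a₀ a₁ := r a₀ ⊆ r a₁`.

The heart is the two-set lemma `omega_add_omega_le`: for type sets `A₀, A₁`,
`ω A₀ + ω A₁ ≤ ω (A₀ ∪ A₁) + ω (nuSet A₀ A₁)` where `nuSet` is the support/domination filter of the inner family; the proof splits
the maximal rows of `A₀` (resp. `A₁`) into those not strictly below (resp. not below-or-equal) a row of the other set — these are
maximal in the union and the two parts are disjoint — and the rest, which are maximal rows of `nuSet` and again disjoint.  At the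
root of the `Q44` recursion every side carries one type, so `Φ_ω = w` (`omega_singleton`); the row hypothesis holds for the 26
oriented `Q44` side types with `r = clickQ`-row and `Mem =` the 18 member types (`q44_memberRow_not_subset`, `decide`).
Consequence (memo §2): along the R5 recursion `2·L − Φ_ω` is super-additive, so R5 certifies a configuration iff some slicing tree
pays for its leaves, `Σ_leaves (2·[leaf clicks] − ω(A_leaf)) + 2·#bonus ≥ 0` — the open invariant problem of gen 23/24 is reduced
to leaf/bonus accounting; the weights are no longer an issue.  No sorries, no named facts, standard axioms.
-/

namespace Summit.CriticalPhenomena.PercolationContinuityZ3.Theorems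

namespace TwoLayerMS

open Finset

variable {T : Type} [DecidableEq T] {U : Type} [DecidableEq U]

section omega

variable (r : T → Finset U) (Mem : T → Prop) [DecidablePred Mem]

/-- The rows of the MEMBER types of a type set `A`: `{r a : a ∈ A, Mem a}`. [this work] -/
def rows (A : Finset T) : Finset (Finset U) := (A.filter fun a => Mem a).image r

/-- The maximal elements (for strict inclusion) of a finite family of finsets. [this work] -/
def maxEls (F : Finset (Finset U)) : Finset (Finset U) := F.filter fun ρ => ∀ σ ∈ F, ¬ ρ ⊂ σ

/-- **The antichain weight** `ω A`: the number of maximal member rows of `A`. [this work] -/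
def omega (A : Finset T) : ℕ := #(maxEls (rows r Mem A))

/-- The support/domination filter of the inner family on type sets: the types of `A₁` whose row is contained in the row of some
type of `A₀` (supported) together with the types of `A₀` whose row is contained in the row of some type of `A₁` (dominated);
written with `decide` exactly as `innerA` reads it. [this work] -/
def nuSet (A₀ A₁ : Finset T) : Finset T :=
  (A₁.filter fun a₁ => ∃ a₀ ∈ A₀, decide (r a₁ ⊆ r a₀) = true) ∪
    (A₀.filter fun a₀ => ∃ a₁ ∈ A₁, decide (r a₀ ⊆ r a₁) = true)

variable {r Mem}

omit [DecidableEq T] in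
/-- Membership in `rows`. [this work] -/
theorem mem_rows {A : Finset T} {ρ : Finset U} : ρ ∈ rows r Mem A ↔ ∃ a ∈ A, Mem a ∧ r a = ρ := by
  unfold rows
  rw [Finset.mem_image]
  constructor
  · rintro ⟨a, ha, h⟩
    rw [Finset.mem_filter] at ha
    exact ⟨a, ha.1, ha.2, h⟩
  · rintro ⟨a, ha, hm, h⟩
    exact ⟨a, Finset.mem_filter.2 ⟨ha, hm⟩, h⟩

omit [DecidableEq T] in
/-- A member's row is a row. [this work] -/
theorem row_mem_rows {A : Finset T} {a : T} (ha : a ∈ A) (hm : Mem a) : r a ∈ rows r Mem A :=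
  mem_rows.2 ⟨a, ha, hm, rfl⟩

/-- Membership in `maxEls`. [this work] -/
theorem mem_maxEls {F : Finset (Finset U)} {ρ : Finset U} : ρ ∈ maxEls F ↔ ρ ∈ F ∧ ∀ σ ∈ F, ¬ ρ ⊂ σ := by
  unfold maxEls; rw [Finset.mem_filter]

/-- `rows` of a union. [this work] -/
theorem rows_union (A₀ A₁ : Finset T) : rows r Mem (A₀ ∪ A₁) = rows r Mem A₀ ∪ rows r Mem A₁ := by
  unfold rows
  rw [Finset.filter_union, Finset.image_union]

omit [DecidableEq T] in
/-- `rows ∅ = ∅`. [this work] -/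
theorem rows_empty : rows r Mem (∅ : Finset T) = ∅ := by
  unfold rows; simp

omit [DecidableEq T] in
/-- `ω ∅ = 0`. [this work] -/
theorem omega_empty : omega r Mem (∅ : Finset T) = 0 := by
  unfold omega maxEls
  rw [rows_empty]
  simp

omit [DecidableEq T] in
/-- `ω {t} = [Mem t]`: at the root of the recursion every side carries one type and `Φ_ω` is the member weight `w`.
[this work] -/
theorem omega_singleton (t : T) : omega r Mem ({t} : Finset T) = if Mem t then 1 else 0 := by
  unfold omega maxEls rows
  by_cases hm : Mem t
  · rw [if_pos hm]
    have h1 : (({t} : Finset T).filter fun a => Mem a) = {t} := by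
      ext a; simp only [Finset.mem_filter, Finset.mem_singleton]
      constructor
      · exact fun h => h.1
      · intro h; subst h; exact ⟨rfl, hm⟩
    rw [h1, Finset.image_singleton]
    have h2 : (({r t} : Finset (Finset U)).filter fun ρ => ∀ σ ∈ ({r t} : Finset (Finset U)), ¬ ρ ⊂ σ) = {r t} := by
      ext ρ; simp only [Finset.mem_filter, Finset.mem_singleton]
      constructor
      · exact fun h => h.1
      · intro h; subst h
        refine ⟨rfl, ?_⟩
        intro σ hσ; subst hσ; exact fun hh => hh.2 hh.1
    rw [h2, Finset.card_singleton]
  · rw [if_neg hm]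
    have h1 : (({t} : Finset T).filter fun a => Mem a) = ∅ := by
      ext a; simp only [Finset.mem_filter, Finset.mem_singleton, Finset.notMem_empty, iff_false, not_and]
      intro h; subst h; exact hm
    rw [h1]; simp

/-- **The two-set lemma.**  If no member row is contained in a non-member row then
`ω A₀ + ω A₁ ≤ ω (A₀ ∪ A₁) + ω (nuSet A₀ A₁)`. [this work] -/
theorem omega_add_omega_le (H : ∀ a q : T, Mem a → ¬ Mem q → ¬ r a ⊆ r q) (A₀ A₁ : Finset T) :
    omega r Mem A₀ + omega r Mem A₁ ≤ omega r Mem (A₀ ∪ A₁) + omega r Mem (nuSet r A₀ A₁) := by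
  -- notation
  set R₀ := rows r Mem A₀ with hR₀
  set R₁ := rows r Mem A₁ with hR₁
  set M₀ := maxEls R₀ with hM₀
  set M₁ := maxEls R₁ with hM₁
  -- split M₀ and M₁
  let X₀ := M₀.filter fun ρ => ∀ σ ∈ R₁, ¬ ρ ⊂ σ
  let Y₀ := M₀.filter fun ρ => ¬ ∀ σ ∈ R₁, ¬ ρ ⊂ σ
  let X₁ := M₁.filter fun ρ => ∀ σ ∈ R₀, ¬ ρ ⊆ σ
  let Y₁ := M₁.filter fun ρ => ¬ ∀ σ ∈ R₀, ¬ ρ ⊆ σ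
  have hM₀card : #X₀ + #Y₀ = #M₀ := Finset.card_filter_add_card_filter_not _
  have hM₁card : #X₁ + #Y₁ = #M₁ := Finset.card_filter_add_card_filter_not _
  have hω₀ : omega r Mem A₀ = #M₀ := rfl
  have hω₁ : omega r Mem A₁ = #M₁ := rfl
  -- (A) X₀ ∪ X₁ ⊆ maxEls (rows (A₀ ∪ A₁)), disjointly
  have hU : rows r Mem (A₀ ∪ A₁) = R₀ ∪ R₁ := rows_union A₀ A₁
  have hX : X₀ ∪ X₁ ⊆ maxEls (rows r Mem (A₀ ∪ A₁)) := by
    intro ρ hρ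
    rw [hU, mem_maxEls]
    rw [Finset.mem_union] at hρ
    rcases hρ with hρ | hρ
    · rw [Finset.mem_filter, mem_maxEls] at hρ
      obtain ⟨⟨hρR, hρmax⟩, hρ1⟩ := hρ
      refine ⟨Finset.mem_union_left _ hρR, ?_⟩
      intro σ hσ
      rw [Finset.mem_union] at hσ
      rcases hσ with hσ | hσ
      · exact hρmax σ hσ
      · exact hρ1 σ hσ
    · rw [Finset.mem_filter, mem_maxEls] at hρ
      obtain ⟨⟨hρR, hρmax⟩, hρ0⟩ := hρ
      refine ⟨Finset.mem_union_right _ hρR, ?_⟩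
      intro σ hσ
      rw [Finset.mem_union] at hσ
      rcases hσ with hσ | hσ
      · exact fun hh => hρ0 σ hσ hh.1
      · exact hρmax σ hσ
  have hXdisj : Disjoint X₀ X₁ := by
    rw [Finset.disjoint_left]
    intro ρ h0 h1
    rw [Finset.mem_filter, mem_maxEls] at h0 h1
    exact h1.2 ρ h0.1.1 (subset_refl ρ)
  -- (B) Y₀ ∪ Y₁ ⊆ maxEls (rows (nuSet A₀ A₁)), disjointly
  have hY : Y₀ ∪ Y₁ ⊆ maxEls (rows r Mem (nuSet r A₀ A₁)) := by
    intro ρ hρ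
    rw [mem_maxEls]
    rw [Finset.mem_union] at hρ
    rcases hρ with hρ | hρ
    · -- ρ ∈ Y₀ : maximal row of A₀ strictly below some row of A₁
      rw [Finset.mem_filter, mem_maxEls] at hρ
      obtain ⟨⟨hρR, hρmax⟩, hρ1⟩ := hρ
      push Not at hρ1
      obtain ⟨σ, hσ, hρσ⟩ := hρ1
      obtain ⟨a₀, ha₀, hm₀, rfl⟩ := mem_rows.1 hρR
      obtain ⟨a₁, ha₁, hm₁, rfl⟩ := mem_rows.1 hσ
      refine ⟨?_, ?_⟩
      · -- membership: a₀ is dominated by a₁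
        refine row_mem_rows ?_ hm₀
        unfold nuSet
        rw [Finset.mem_union]; right
        rw [Finset.mem_filter]
        exact ⟨ha₀, a₁, ha₁, decide_eq_true hρσ.1⟩
      · -- maximality among the rows of nuSet
        intro τ hτ hρτ
        obtain ⟨c, hc, hmc, rfl⟩ := mem_rows.1 hτ
        unfold nuSet at hc
        rw [Finset.mem_union, Finset.mem_filter, Finset.mem_filter] at hc
        rcases hc with ⟨hc1, a, ha, hca⟩ | ⟨hc0, _⟩
        · -- c ∈ A₁ supported by a ∈ A₀; a is a member by H, so r c ⊆ r a ∈ R₀ and r a₀ ⊂ r a: contradiction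
          have hca' : r c ⊆ r a := of_decide_eq_true hca
          have hma : Mem a := by
            by_contra hna; exact H c a hmc hna hca'
          exact hρmax (r a) (row_mem_rows ha hma) (lt_of_lt_of_le hρτ hca')
        · -- c ∈ A₀ member: r a₀ ⊂ r c ∈ R₀ contradicts maximality
          exact hρmax (r c) (row_mem_rows hc0 hmc) hρτ
    · -- ρ ∈ Y₁ : maximal row of A₁ below-or-equal some row of A₀
      rw [Finset.mem_filter, mem_maxEls] at hρ
      obtain ⟨⟨hρR, hρmax⟩, hρ0⟩ := hρ
      push Not at hρ0
      obtain ⟨σ, hσ, hρσ⟩ := hρ0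
      obtain ⟨a₁, ha₁, hm₁, rfl⟩ := mem_rows.1 hρR
      obtain ⟨a₀, ha₀, hm₀, rfl⟩ := mem_rows.1 hσ
      refine ⟨?_, ?_⟩
      · refine row_mem_rows ?_ hm₁
        unfold nuSet
        rw [Finset.mem_union]; left
        rw [Finset.mem_filter]
        exact ⟨ha₁, a₀, ha₀, decide_eq_true hρσ⟩
      · intro τ hτ hρτ
        obtain ⟨c, hc, hmc, rfl⟩ := mem_rows.1 hτ
        unfold nuSet at hc
        rw [Finset.mem_union, Finset.mem_filter, Finset.mem_filter] at hc
        rcases hc with ⟨hc1, _⟩ | ⟨hc0, a, ha, hca⟩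
        · -- c ∈ A₁ member: r a₁ ⊂ r c ∈ R₁ contradicts maximality
          exact hρmax (r c) (row_mem_rows hc1 hmc) hρτ
        · -- c ∈ A₀ dominated by a ∈ A₁; a member by H; r a₁ ⊂ r c ⊆ r a ∈ R₁: contradiction
          have hca' : r c ⊆ r a := of_decide_eq_true hca
          have hma : Mem a := by
            by_contra hna; exact H c a hmc hna hca'
          exact hρmax (r a) (row_mem_rows ha hma) (lt_of_lt_of_le hρτ hca')
  have hYdisj : Disjoint Y₀ Y₁ := by
    rw [Finset.disjoint_left]
    intro ρ h0 h1
    rw [Finset.mem_filter, mem_maxEls] at h0 h1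
    obtain ⟨⟨_, _⟩, h0'⟩ := h0
    push Not at h0'
    obtain ⟨σ, hσ, hρσ⟩ := h0'
    exact h1.1.2 σ hσ hρσ
  -- count
  have hA : #X₀ + #X₁ ≤ omega r Mem (A₀ ∪ A₁) := by
    unfold omega
    rw [← Finset.card_union_of_disjoint hXdisj]
    exact Finset.card_le_card hX
  have hB : #Y₀ + #Y₁ ≤ omega r Mem (nuSet r A₀ A₁) := by
    unfold omega
    rw [← Finset.card_union_of_disjoint hYdisj]
    exact Finset.card_le_card hY
  rw [hω₀, hω₁, ← hM₀card, ← hM₁card]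
  omega

end omega

/-! ## The family-level inequality -/

section family

variable {γ : Type} [Fintype γ] [DecidableEq γ]
variable (r : T → Finset U) (Mem : T → Prop) [DecidablePred Mem]

/-- **The antichain potential** of a two-layer family (only the active layer matters): `Φ_ω A = ∑_X ω (A X)`. [this work] -/
def phiOmega (A : Finset γ → Finset T) : ℕ := ∑ X : Finset γ, omega r Mem (A X)

/-- The support relation by row inclusion: `S a₀ a₁ ⇔ r a₁ ⊆ r a₀`. [this work] -/
def rowS : T → T → Bool := fun a₀ a₁ => decide (r a₁ ⊆ r a₀)

/-- The domination relation by row inclusion: `D a₀ a₁ ⇔ r a₀ ⊆ r a₁`. [this work] -/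
def rowD : T → T → Bool := fun a₀ a₁ => decide (r a₀ ⊆ r a₁)

variable {r Mem}

omit [Fintype γ] in
/-- On a set not containing `e` the inner active layer is `nuSet (A X) (A (insert e X))`. [this work] -/
theorem innerA_eq_nuSet (A : Finset γ → Finset T) (e : γ) {X : Finset γ} (hX : e ∉ X) :
    innerA A e (rowS r) (rowD r) X = nuSet r (A X) (A (insert e X)) := by
  unfold innerA domPart nuSet rowS rowD
  rw [if_neg hX]

/-- Reindexing: summing `f (insert e X)` over the sets without `e` is summing `f` over the sets with `e`. [folklore] -/
theorem sum_insert_reindex (e : γ) (f : Finset γ → ℕ) :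
    ∑ X ∈ (Finset.univ : Finset (Finset γ)).filter (fun X => e ∉ X), f (insert e X) =
      ∑ X ∈ (Finset.univ : Finset (Finset γ)).filter (fun X => e ∈ X), f X := by
  have hinj : Set.InjOn (fun X : Finset γ => insert e X) ↑((Finset.univ : Finset (Finset γ)).filter fun X => e ∉ X) := by
    intro X hX Y hY h
    rw [Finset.coe_filter] at hX hY
    have h' : (insert e X).erase e = (insert e Y).erase e := by
      simp only at h; rw [h]
    rwa [Finset.erase_insert hX.2, Finset.erase_insert hY.2] at h'
  have himg : ((Finset.univ : Finset (Finset γ)).filter fun X => e ∉ X).image (fun X => insert e X) =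
      (Finset.univ : Finset (Finset γ)).filter fun X => e ∈ X := by
    ext Y
    rw [Finset.mem_image, Finset.mem_filter]
    constructor
    · rintro ⟨X, hX, rfl⟩
      exact ⟨Finset.mem_univ _, Finset.mem_insert_self _ _⟩
    · rintro ⟨_, hY⟩
      refine ⟨Y.erase e, ?_, Finset.insert_erase hY⟩
      rw [Finset.mem_filter]
      exact ⟨Finset.mem_univ _, Finset.notMem_erase _ _⟩
  rw [← himg, Finset.sum_image hinj]

/-- **`Φ_ω` is sub-additive under every R5 split**: if no member row is contained in a non-member row, then for every
two-layer active layer `A` and every element `e`,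
`Φ_ω A ≤ Φ_ω (outerA A e) + Φ_ω (innerA A e (rowS r) (rowD r))`. [this work] -/
theorem phiOmega_le_outer_add_inner (H : ∀ a q : T, Mem a → ¬ Mem q → ¬ r a ⊆ r q)
    (A : Finset γ → Finset T) (e : γ) :
    phiOmega r Mem A ≤ phiOmega r Mem (outerA A e) + phiOmega r Mem (innerA A e (rowS r) (rowD r)) := by
  unfold phiOmega
  set F0 := (Finset.univ : Finset (Finset γ)).filter (fun X => e ∉ X) with hF0
  set F1 := (Finset.univ : Finset (Finset γ)).filter (fun X => e ∈ X) with hF1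
  -- split every sum into the part without `e` and the part with `e`
  have split : ∀ f : Finset γ → ℕ, ∑ X : Finset γ, f X = ∑ X ∈ F0, f X + ∑ X ∈ F1, f X := by
    intro f
    rw [hF0, hF1]
    have h := Finset.sum_filter_add_sum_filter_not (Finset.univ : Finset (Finset γ)) (fun X => e ∈ X) f
    omega
  rw [split (fun X => omega r Mem (A X)), split (fun X => omega r Mem (outerA A e X)),
    split (fun X => omega r Mem (innerA A e (rowS r) (rowD r) X))]
  -- the parts with `e`: original = reindexed, outer/inner vanish
  have hA1 : ∑ X ∈ F1, omega r Mem (A X) = ∑ X ∈ F0, omega r Mem (A (insert e X)) :=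
    (sum_insert_reindex e (fun X => omega r Mem (A X))).symm
  have hO1 : ∑ X ∈ F1, omega r Mem (outerA A e X) = 0 := by
    refine Finset.sum_eq_zero ?_
    intro X hX
    rw [hF1, Finset.mem_filter] at hX
    unfold outerA; rw [if_pos hX.2, omega_empty]
  have hI1 : ∑ X ∈ F1, omega r Mem (innerA A e (rowS r) (rowD r) X) = 0 := by
    refine Finset.sum_eq_zero ?_
    intro X hX
    rw [hF1, Finset.mem_filter] at hX
    unfold innerA; rw [if_pos hX.2, omega_empty]
  -- the parts without `e`: termwise two-set lemma
  have hO0 : ∑ X ∈ F0, omega r Mem (outerA A e X) = ∑ X ∈ F0, omega r Mem (A X ∪ A (insert e X)) := by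
    refine Finset.sum_congr rfl ?_
    intro X hX
    rw [hF0, Finset.mem_filter] at hX
    unfold outerA; rw [if_neg hX.2]
  have hI0 : ∑ X ∈ F0, omega r Mem (innerA A e (rowS r) (rowD r) X) =
      ∑ X ∈ F0, omega r Mem (nuSet r (A X) (A (insert e X))) := by
    refine Finset.sum_congr rfl ?_
    intro X hX
    rw [hF0, Finset.mem_filter] at hX
    rw [innerA_eq_nuSet A e hX.2]
  rw [hA1, hO1, hI1, hO0, hI0, Nat.add_zero, Nat.add_zero, ← Finset.sum_add_distrib, ← Finset.sum_add_distrib]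
  refine Finset.sum_le_sum ?_
  intro X _
  exact omega_add_omega_le H (A X) (A (insert e X))

/-- The row relations satisfy the support/domination hypotheses of `card_outer_add_card_inner_le` when `r a` is the `Q`-row of
`a` inside a type universe containing all partners: stated for `r a := 𝒯.filter (Q a ·)`. [this work] -/
theorem rowS_support (Q : T → T → Bool) (𝒯 : Finset T) (a₀ a₁ : T)
    (h : rowS (fun a => 𝒯.filter fun c => Q a c = true) a₀ a₁ = true) :
    ∀ c ∈ 𝒯, Q a₁ c = true → Q a₀ c = true := by
  unfold rowS at h
  have h' := of_decide_eq_true h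
  intro c hc hq
  have hm : c ∈ 𝒯.filter fun c => Q a₁ c = true := Finset.mem_filter.2 ⟨hc, hq⟩
  exact (Finset.mem_filter.1 (h' hm)).2

end family

/-! ## The `Q44` instance of the row hypothesis -/

section q44

open TwoCopyMono

/-- The 26 oriented `Q44` side types: the 18 member types (`q44B1`, both orientations; the eight dart pair-sides `q44Darts`)
and the eight reversed darts (block; pair). [this work] -/
def q44Types : Finset (Fin 15 × Fin 15) := q44B1 ∪ q44Darts ∪ q44Darts.image fun p => (p.2, p.1)

/-- The 18 member types of `Q44`. [this work] -/
def q44Members : Finset (Fin 15 × Fin 15) := q44B1 ∪ q44Darts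

/-- The `clickQ`-row of a type inside the 26-type universe. [this work] -/
def q44Row (a : Fin 15 × Fin 15) : Finset (Fin 15 × Fin 15) := q44Types.filter fun c => clickQ a c = true

set_option maxRecDepth 4000 in
/-- **Row hypothesis for `Q44`** (table check): inside the 26 oriented side types, no member's `clickQ`-row is contained in the
row of a non-member (the reversed darts have rows of size ≤ 5, members ≥ 8).  Hence `phiOmega_le_outer_add_inner` applies to
every two-layer family whose type sets stay inside `q44Types` with `r = q44Row`, `Mem = (· ∈ q44Members)`. [this work] -/
theorem q44_memberRow_not_subset :
    ∀ a ∈ q44Types, ∀ q ∈ q44Types, a ∈ q44Members → q ∉ q44Members → ¬ q44Row a ⊆ q44Row q := by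
  decide +kernel

end q44

end TwoLayerMS

end Summit.CriticalPhenomena.PercolationContinuityZ3.Theorems
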